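import Literature.Analysis.FunctionSpaces.BesovDifference
import HarnessLib

/-!
# Discharges for `Literature.Analysis.FunctionSpaces.BesovDifference`

Sorry-free proofs of named facts of the Nikol'skii–Besov difference-quotient classes
`B^s_{p,∞}` (`Literature.Analysis.FunctionSpaces.MemBesovSup`), kept in a sibling file so that the definitions file is unchanged.

* `Literature.MemBesovSup.mono_exponent_holds : Literature.MemBesovSup.mono_exponent` — `B^s_{p,∞} ⊂ B^{s'}_{p,∞}`
  for `s' ≤ s` on a bounded group (difference-quotient counterpart of Triebel 1983, §2.3.2,
  Proposition 2 (ii), eq. (7)).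
* `Literature.MemBesovSup.memBesovSupVanishing_of_lt_holds : Literature.MemBesovSup.memBesovSupVanishing_of_lt`
  — `B^s_{p,∞} ⊂ B^{s'}_{p,c₀}` for `s' < s`, likewise **on a bounded group only** (the section
  instance `[BoundedSpace G]`, which the named fact's Lean signature lost; the unguarded family is
  refuted by `Literature.Analysis.FunctionSpaces.MemBesovSup.not_memBesovSupVanishing_of_lt` in `BesovDifference`): it is
  `Literature.Analysis.FunctionSpaces.MemBesovSup.memBesovSupVanishing_of_lt'` (difference-quotient counterpart of
  `B^{1/3}_{3,p} ⊂ B^{1/3}_{3,c(ℕ)}`, CCFS 2008, §3.2, p. 6).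
* `Literature.Torus.IsSmooth.memBesovSup_holds : Literature.Torus.IsSmooth.memBesovSup` — smooth functions on
  the flat torus `𝕋^d` lie in `B^s_{p,∞}(𝕋^d)` for every `s ≤ 1` and every exponent `p`
  (first-difference / mean-value estimate on the periodic lift; the spaces are those of
  CCFS 2008, §2, Defs 2.1–2.2, in the equivalent difference form of Triebel 1983, Thm 2.5.12,
  eq. (4) with `M = 1`). Helpers (all `[folklore]`): `Literature.Analysis.FunctionSpaces.Torus.exists_proj_eq_and_norm_le`
  (nearest-integer lift of an increment, `‖v‖ ≤ √(card d) ‖h‖`),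
  `Literature.Analysis.FunctionSpaces.Torus.norm_unitAddTorus_le_one`, `Literature.Analysis.FunctionSpaces.Torus.IsContDiff.exists_norm_fderiv_lift_le`
  (the derivative of the periodic lift of a `C^n` function, `n ≠ 0`, is bounded),
  `Literature.Analysis.FunctionSpaces.Torus.IsContDiff.exists_norm_sub_le_mul` (`‖f (x + h) - f x‖ ≤ L ‖h‖`).
* `Literature.Torus.IsSmooth.memBesovSupVanishing_holds : Literature.Torus.IsSmooth.memBesovSupVanishing` —
  smooth functions on `𝕋^d` lie in every `B^s_{p,c₀}(𝕋^d)`, `s < 1`: the previous item at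
  exponent `1` and `B¹_{p,∞} ⊂ B^s_{p,c₀}` on the bounded torus
  (`Literature.Analysis.FunctionSpaces.Torus.IsSmooth.memBesovSupVanishing_of_memBesovSup`, i.e.
  `Literature.Analysis.FunctionSpaces.MemBesovSup.memBesovSupVanishing_of_lt'`; CCFS 2008, §3.2).

* `Literature.Analysis.FunctionSpaces.MemBesovSup.add_holds : Literature.Analysis.FunctionSpaces.MemBesovSup.add`
  — `B^s_{p,∞}(μ)` is closed under addition for a right-translation-invariant measure on a
  measurable group, every `s` and every exponent `p ∈ [0, ∞]` (quasi-subadditivity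
  `Literature.Analysis.FunctionSpaces.eBesovSupSeminorm_add_le_mul` of the difference seminorm with
  Mathlib's quasi-triangle constant `ENNReal.LpAddConst p`, genuine subadditivity
  `Literature.Analysis.FunctionSpaces.eBesovSupSeminorm_add_le` for `1 ≤ p`), with the corollaries
  `MemBesovSup.add'`, `MemBesovSup.sub'` and the a.e.-class invariance
  `Literature.Analysis.FunctionSpaces.eBesovSupSeminorm_congr_of_ae_eq`, `MemBesovSup.ae_eq`.

## References

* H. Triebel, *Theory of Function Spaces*, Monographs in Mathematics 78, Birkhäuser (1983),
  §2.3.2, Proposition 2 (elementary embeddings), PDF pp. 165–166; §2.2.2 eq. (5) (first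
  difference `Δ_h^1 f = f(· + h) - f`) and Thm 2.5.12 eq. (4) (difference quasi-norm of
  `B^s_{p,∞}`) [TriebelTFS1983].
* A. Cheskidov, P. Constantin, S. Friedlander, R. Shvydkoy, *Energy conservation and Onsager's
  conjecture for the Euler equations*, Nonlinearity 21 (2008) 1233–1252 (arXiv:0704.0759), §2
  "Preliminaries", Defs 2.1–2.2 (the Besov spaces `B^s_{p,r}`) [CCFS2008].
-/

open Set MeasureTheory
open scoped ENNReal

noncomputable section

namespace Literature.Analysis.FunctionSpaces

variable {G : Type*} {F : Type*} [NormedAddCommGroup G] [MeasurableSpace G] [NormedAddCommGroup F]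
  [BoundedSpace G] {s s' : ℝ} {p : ℝ≥0∞} {f : G → F} {μ : Measure G}

/-- Discharge of `MemBesovSup.mono_exponent`. On a bounded `G` pick `R` with `‖h‖ ≤ R` for all
`h` and put `M := max R 1 ≥ 1`; for `h ≠ 0` and `s' ≤ s`,
`‖h‖ ^ s = ‖h‖ ^ (s - s') * ‖h‖ ^ s' ≤ M ^ (s - s') * ‖h‖ ^ s'`, whence
`‖f(· + h) - f‖_{L^p} ≤ [f]_{B^s_{p,∞}} ‖h‖ ^ s ≤ M ^ (s - s') [f]_{B^s_{p,∞}} ‖h‖ ^ s'`, i.e.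
`[f]_{B^{s'}_{p,∞}} ≤ M ^ (s - s') [f]_{B^s_{p,∞}} < ∞`; the `L^p` part is unchanged. This is the
difference-quotient counterpart, on a bounded group, of the elementary embedding
`B^{s+ε}_{p,q₀}(ℝⁿ) ⊂ B^s_{p,q₁}(ℝⁿ)` (`ε > 0`, `0 < p ≤ ∞`, `0 < q₀, q₁ ≤ ∞`) of Triebel 1983,
§2.3.2, Proposition 2 (ii), eq. (7), printed there for the Fourier-analytic spaces on `ℝⁿ`
(here `q₀ = q₁ = ∞`, and `ε = s - s' = 0` is the trivial case).
[cite: TriebelTFS1983, §2.3.2 Prop. 2(ii) eq. (7)] -/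
theorem MemBesovSup.mono_exponent_holds :
    MemBesovSup.mono_exponent (s := s) (s' := s') (p := p) (f := f) (μ := μ) := by
  intro hf hs
  refine ⟨hf.1, ?_⟩
  obtain ⟨R, hR⟩ := (Bornology.IsBounded.all (Set.univ : Set G)).exists_norm_le
  set M : ℝ := max R 1
  have hM0 : 0 ≤ M := zero_le_one.trans (le_max_right _ _)
  refine lt_of_le_of_lt ?_ (ENNReal.mul_lt_top (ENNReal.ofReal_lt_top (r := M ^ (s - s'))) hf.2)
  rw [eBesovSupSeminorm_def]
  refine iSup₂_le fun h hh => ?_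
  rw [ENNReal.div_le_iff (ofReal_norm_rpow_pos s' hh).ne' ENNReal.ofReal_ne_top]
  have hpos : 0 < ‖h‖ := norm_pos_iff.2 hh
  have hpow : ‖h‖ ^ s ≤ M ^ (s - s') * ‖h‖ ^ s' :=
    calc ‖h‖ ^ s = ‖h‖ ^ (s - s') * ‖h‖ ^ s' := by rw [← Real.rpow_add hpos, sub_add_cancel]
      _ ≤ M ^ (s - s') * ‖h‖ ^ s' :=
        mul_le_mul_of_nonneg_right
          (Real.rpow_le_rpow (norm_nonneg _) ((hR h (Set.mem_univ _)).trans (le_max_left _ _))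
            (sub_nonneg.2 hs))
          (Real.rpow_nonneg (norm_nonneg _) _)
  calc eLpNorm (fun x => f (x + h) - f x) p μ
      ≤ eBesovSupSeminorm s p f μ * ENNReal.ofReal (‖h‖ ^ s) :=
        eLpNorm_sub_le_eBesovSupSeminorm_mul hh
    _ ≤ eBesovSupSeminorm s p f μ *
          (ENNReal.ofReal (M ^ (s - s')) * ENNReal.ofReal (‖h‖ ^ s')) := by
        rw [← ENNReal.ofReal_mul (Real.rpow_nonneg hM0 _)]
        exact mul_le_mul_right (ENNReal.ofReal_le_ofReal hpow) _
    _ = ENNReal.ofReal (M ^ (s - s')) * eBesovSupSeminorm s p f μ * ENNReal.ofReal (‖h‖ ^ s') := by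
        ring

/-- Discharge of `MemBesovSup.memBesovSupVanishing_of_lt` **at every bounded `G`, and only there**
(the same family reading as `MemBesovSup.mono_exponent_holds` above). The named fact is a `Prop`
family indexed by the implicit `G, F, s, s', p, f, μ`; its Lean signature lost the standing
hypothesis "`G` bounded" (the torus / a bounded domain in the sources) because a `def` abstracts
only the section variables its body mentions. This theorem carries that hypothesis as the section
instance `[BoundedSpace G]` and is `MemBesovSup.memBesovSupVanishing_of_lt'`:
`B^s_{p,∞} ⊂ B^{s'}_{p,c₀}` for `s' < s`, because the order-`s'` difference quotient is
`≤ [f]_{B^s_{p,∞}} ‖h‖^{s-s'} → 0` as `h → 0` (and `B^s_{p,∞} ⊂ B^{s'}_{p,∞}` for the membership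
part). The unguarded family is **false** — `MemBesovSup.not_memBesovSupVanishing_of_lt`
(`G = F = ℝ`, `μ = δ₀`, `p = 1`, `f = id`, `s = 1`, `s' = 0`) — so no instance-free proof of the
fully quantified statement exists; the closed, corrected named fact is
`MemBesovSup.memBesovSupVanishing_of_lt_of_boundedSpace` (discharged in `BesovDifference`).
Source: the difference-quotient counterpart of "Notice that the Besov spaces `B^{1/3}_{3,p}` for
`1 ≤ p < ∞`, and in particular `B^{1/3}_{3,2}` are included in `B^{1/3}_{3,c(ℕ)}`"
(Cheskidov–Constantin–Friedlander–Shvydkoy 2008, §3.2, p. 6, right after the definition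
`lim_{q → ∞} λ_q^{1/3} ‖Δ_q u‖₃ = 0` of `B^{1/3}_{3,c(ℕ)}`), combined with the elementary embedding
`B^{s+ε}_{p,q₀} ⊂ B^{s}_{p,q₁}`, `ε > 0` (Triebel 1983, §2.3.2, Prop. 2 (ii), eq. (7)).
[cite: CCFS2008, §3.2] [cite: TriebelTFS1983, §2.3.2 Prop. 2(ii) eq. (7)] -/
theorem MemBesovSup.memBesovSupVanishing_of_lt_holds :
    MemBesovSup.memBesovSupVanishing_of_lt (s := s) (s' := s') (p := p) (f := f) (μ := μ) :=
  fun hf hs => hf.memBesovSupVanishing_of_lt' hs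

end Literature.Analysis.FunctionSpaces

/-! ## Smooth functions on the flat torus: `C^∞(𝕋^d) ⊂ B^s_{p,∞}(𝕋^d)`, `s ≤ 1`

Discharge of the named fact `Literature.Analysis.FunctionSpaces.Torus.IsSmooth.memBesovSup`. Neither CCFS 2008 (§2) nor
Triebel 1983 (Thm 2.5.12) spells out this elementary inclusion; its architecture is the
first-difference estimate `‖Δ_h f‖_{L^p(𝕋^d)} ≤ ‖Δ_h f‖_{L^∞} ≤ L |h|`,
`L = √d · sup ‖∇(f ∘ proj)‖ < ∞`, whence `|h|^{-s} ‖Δ_h f‖_{L^p} ≤ L |h|^{1-s} ≤ L` since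
`|h| ≤ 1/2` on `(ℝ/ℤ)^d` and `s ≤ 1`. -/

namespace Literature.Analysis.FunctionSpaces

open Filter Topology
open scoped NNReal

namespace Torus

variable {d : Type*} [Fintype d]

/-- Every increment `h ∈ 𝕋^d = (ℝ/ℤ)^d` lifts along `proj` to a vector `v ∈ ℝ^d` whose coordinates
are the nearest-integer representatives `x - round x`, so that `|v i| = ‖h i‖`
(`UnitAddCircle.norm_eq : ‖(x : ℝ/ℤ)‖ = |x - round x|`) and hence `‖v‖ ≤ √(card d) ‖h‖` for the
Euclidean norm on `ℝ^d` and the sup norm on `𝕋^d`. [folklore] -/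
theorem exists_proj_eq_and_norm_le (h : UnitAddTorus d) :
    ∃ v : EuclideanSpace ℝ d, proj v = h ∧ ‖v‖ ≤ Real.sqrt (Fintype.card d) * ‖h‖ := by
  have hc : ∀ i, ∃ r : ℝ, (r : UnitAddCircle) = h i ∧ |r| = ‖h i‖ := by
    intro i
    obtain ⟨x, hx⟩ := QuotientAddGroup.mk_surjective (h i)
    refine ⟨x - round x, ?_, ?_⟩
    · rw [← hx, AddCircle.coe_sub, sub_eq_self]
      exact (AddCircle.coe_eq_zero_iff (1 : ℝ)).2 ⟨round x, by simp⟩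
    · rw [← hx]
      exact (UnitAddCircle.norm_eq (x := x)).symm
  choose r hr hrn using hc
  refine ⟨WithLp.toLp 2 r, funext fun i => hr i, ?_⟩
  rw [EuclideanSpace.norm_eq]
  calc √(∑ i, ‖(WithLp.toLp 2 r : EuclideanSpace ℝ d) i‖ ^ 2)
      ≤ √(∑ _i : d, ‖h‖ ^ 2) := by
        gcongr with i
        rw [PiLp.toLp_apply, Real.norm_eq_abs, hrn i]
        exact norm_le_pi_norm h i
    _ = Real.sqrt (Fintype.card d) * ‖h‖ := by
        rw [Finset.sum_const, Finset.card_univ, nsmul_eq_mul, Real.sqrt_mul (Nat.cast_nonneg _),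
          Real.sqrt_sq (norm_nonneg _)]

/-- Every point of the flat torus has norm at most `1` (indeed `≤ 1/2` coordinatewise,
`AddCircle.norm_le_half_period`; the norm on `𝕋^d` is the sup of the quotient norms). [folklore] -/
theorem norm_unitAddTorus_le_one (h : UnitAddTorus d) : ‖h‖ ≤ 1 :=
  (pi_norm_le_iff_of_nonneg zero_le_one).2 fun _ =>
    (AddCircle.norm_le_half_period (1 : ℝ) one_ne_zero).trans (by norm_num)

variable {F : Type*} [NormedAddCommGroup F] [NormedSpace ℝ F] {f : UnitAddTorus d → F}

/-- For a `C^n` function on the torus, `n ≠ 0`, the derivative of the periodic lift `f ∘ proj` is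
bounded on all of `ℝ^d`: it is the lift of the continuous function `x ↦ fderiv ℝ (liftAt f x) 0`
on the compact torus (`fderiv_comp_add_left`, `continuous_lift_iff`,
`IsCompact.exists_bound_of_continuousOn`). [folklore] -/
theorem IsContDiff.exists_norm_fderiv_lift_le {n : WithTop ℕ∞} (hf : IsContDiff n f)
    (hn : n ≠ 0) : ∃ C, ∀ y, ‖fderiv ℝ (lift f) y‖ ≤ C := by
  set g : UnitAddTorus d → EuclideanSpace ℝ d →L[ℝ] F := fun x => fderiv ℝ (Torus.liftAt f x) 0
    with hg_def
  have hg : lift g = fderiv ℝ (lift f) := by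
    funext y
    simp only [lift_apply, hg_def, liftAt_proj]
    rw [show (lift f ∘ fun x => y + x) = fun x => lift f (y + x) from rfl, fderiv_comp_add_left,
      add_zero]
  have hgc : Continuous g := by
    rw [← continuous_lift_iff, hg]
    exact ContDiff.continuous_fderiv hf hn
  obtain ⟨C, hC⟩ := isCompact_univ.exists_bound_of_continuousOn hgc.continuousOn
  refine ⟨C, fun y => ?_⟩
  have := hC (proj y) (mem_univ _)
  rwa [← lift_apply g y, hg] at this

/-- `C^n` functions on the flat torus, `n ≠ 0`, are Lipschitz for the quotient sup norm:
`‖f (x + h) - f x‖ ≤ L ‖h‖` for all `x h : 𝕋^d`, with `L = √(card d) · sup ‖∇(f ∘ proj)‖`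
(mean value inequality `Convex.norm_image_sub_le_of_norm_fderiv_le` for the periodic lift on
`ℝ^d`, the bound `IsContDiff.exists_norm_fderiv_lift_le`, and the nearest-integer lift of the
increment `exists_proj_eq_and_norm_le`). [folklore] -/
theorem IsContDiff.exists_norm_sub_le_mul {n : WithTop ℕ∞} (hf : IsContDiff n f) (hn : n ≠ 0) :
    ∃ L : ℝ, 0 ≤ L ∧ ∀ x h : UnitAddTorus d, ‖f (x + h) - f x‖ ≤ L * ‖h‖ := by
  obtain ⟨C, hC⟩ := hf.exists_norm_fderiv_lift_le hn
  have hC0 : 0 ≤ C := (norm_nonneg _).trans (hC 0)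
  refine ⟨C * Real.sqrt (Fintype.card d), by positivity, fun x h => ?_⟩
  obtain ⟨y, rfl⟩ := proj_surjective x
  obtain ⟨v, rfl, hv⟩ := exists_proj_eq_and_norm_le h
  have hdiff : Differentiable ℝ (lift f) := ContDiff.differentiable hf hn
  have hmv := convex_univ.norm_image_sub_le_of_norm_fderiv_le (𝕜 := ℝ) (f := lift f)
    (fun z _ => hdiff z) (fun z _ => hC z) (mem_univ y) (mem_univ (y + v))
  rw [lift_apply, lift_apply, proj_add, add_sub_cancel_left] at hmv
  calc ‖f (proj y + proj v) - f (proj y)‖ ≤ C * ‖v‖ := hmv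
    _ ≤ C * (Real.sqrt (Fintype.card d) * ‖proj v‖) := by gcongr
    _ = C * Real.sqrt (Fintype.card d) * ‖proj v‖ := by ring

/-- Discharge of the named fact `IsSmooth.memBesovSup`: smooth functions on the flat torus `𝕋^d`
lie in `B^s_{p,∞}(𝕋^d)` for every `s ≤ 1` and every exponent `p`.

Sources. Cheskidov–Constantin–Friedlander–Shvydkoy, *Energy conservation and Onsager's
conjecture for the Euler equations*, Nonlinearity 21 (2008) (arXiv:0704.0759), §2
"Preliminaries", Defs 2.1–2.2, introduce the inhomogeneous Besov spaces `B^s_{p,r}`, `s ∈ ℝ`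
("Let `s` be a real number, `p` and `r` two real numbers greater than `1`. Then
`‖u‖_{B^s_{p,r}} := ‖Δ_{-1}u‖_{L^p} + ‖(λ_q^s ‖Δ_q u‖_{L^p})_{q ∈ ℕ}‖_{ℓ^r(ℕ)}` is the
inhomogeneous Besov norm"; Littlewood–Paley form, on `ℝ³`). The difference form vendored in
`BesovDifference`, `‖f‖_{L^p} + sup_{h ≠ 0} |h|^{-s} ‖Δ_h^M f‖_{L^p}`, `M > s`, is the equivalent
quasi-norm of Triebel, *Theory of Function Spaces* (1983), Thm 2.5.12, eq. (4) ("are equivalent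
quasi-norms in `B^s_{p,q}(R_n)` (modification if `q = ∞`)"), here with `M = 1` and
`Δ_h^1 f = f(· + h) - f` (ibid. §2.2.2, eq. (5)). Neither source spells out the elementary
inclusion `C^∞(𝕋^d) ⊂ B^s_{p,∞}(𝕋^d)`, `s ≤ 1`; its architecture is the first-difference
estimate: for `f ∈ C¹(𝕋^d)`, `‖Δ_h f‖_{L^p(𝕋^d)} ≤ ‖Δ_h f‖_{L^∞} ≤ L |h|` with
`L = √d · sup_{ℝ^d} ‖∇(f ∘ proj)‖ < ∞` (mean value inequality; the derivative of the periodic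
lift is periodic and continuous, hence bounded), so that
`|h|^{-s} ‖Δ_h f‖_{L^p} ≤ L |h|^{1-s} ≤ L` because `|h| ≤ 1/2 ≤ 1` on `𝕋^d = (ℝ/ℤ)^d` and
`1 - s ≥ 0`.

Proof (Lean). `f ∈ L^p(𝕋^d)` is `IsSmooth.memLp`. For the seminorm, bound every difference
quotient at `h ≠ 0` by `ENNReal.ofReal L`: `IsContDiff.exists_norm_sub_le_mul` (with `n = ∞`)
gives `‖f (x + h) - f x‖ ≤ L‖h‖` for all `x`, hence
`eLpNorm (f(· + h) - f) p volume ≤ volume univ ^ p.toReal⁻¹ * ENNReal.ofReal (L‖h‖)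
= ENNReal.ofReal (L‖h‖)` (`eLpNorm_le_of_ae_bound`; `volume` on `𝕋^d` is a probability measure),
and `L‖h‖ / ‖h‖^s ≤ L` since `‖h‖ = ‖h‖^1 ≤ ‖h‖^s` for `0 < ‖h‖ ≤ 1` and `s ≤ 1`
(`norm_unitAddTorus_le_one`, `Real.rpow_le_rpow_of_exponent_ge`); `ENNReal.ofReal_div_of_pos`
handles the division (no junk: `‖h‖^s > 0`).
[cite: CCFS2008, §2, Defs 2.1–2.2] [cite: TriebelTFS1983, Thm 2.5.12, eq. (4)] -/
theorem IsSmooth.memBesovSup_holds : IsSmooth.memBesovSup (d := d) (F := F) (f := f) := by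
  intro hf s hs p
  refine ⟨hf.memLp p, ?_⟩
  have hinf : ((⊤ : ℕ∞) : WithTop ℕ∞) ≠ 0 := by simp
  obtain ⟨L, hL0, hL⟩ := IsContDiff.exists_norm_sub_le_mul (n := (⊤ : ℕ∞)) hf hinf
  refine lt_of_le_of_lt (iSup₂_le fun h hh => ?_) (ENNReal.ofReal_lt_top (r := L))
  have hpos : 0 < ‖h‖ := norm_pos_iff.2 hh
  have h1 : eLpNorm (fun x => f (x + h) - f x) p volume ≤ ENNReal.ofReal (L * ‖h‖) := by
    refine (eLpNorm_le_of_ae_bound (Eventually.of_forall fun x => hL x h)).trans ?_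
    rw [measure_univ, ENNReal.one_rpow, one_mul]
  rw [eDiffQuotient_def]
  calc eLpNorm (fun x => f (x + h) - f x) p volume / ENNReal.ofReal (‖h‖ ^ s)
      ≤ ENNReal.ofReal (L * ‖h‖) / ENNReal.ofReal (‖h‖ ^ s) := by gcongr
    _ = ENNReal.ofReal (L * ‖h‖ / ‖h‖ ^ s) :=
        (ENNReal.ofReal_div_of_pos (Real.rpow_pos_of_pos hpos s)).symm
    _ ≤ ENNReal.ofReal L := ENNReal.ofReal_le_ofReal ?_
  rw [mul_div_assoc]
  refine mul_le_of_le_one_right hL0 ?_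
  rw [div_le_one (Real.rpow_pos_of_pos hpos s)]
  calc ‖h‖ = ‖h‖ ^ (1 : ℝ) := (Real.rpow_one _).symm
    _ ≤ ‖h‖ ^ s := Real.rpow_le_rpow_of_exponent_ge hpos (norm_unitAddTorus_le_one h) hs

/-- Discharge of `IsSmooth.memBesovSupVanishing`: smooth functions on the flat torus lie in every
`B^s_{p,c₀}(𝕋^d)`, `s < 1` — `IsSmooth.memBesovSup_holds` at exponent `1`, then
`B¹_{p,∞}(𝕋^d) ⊂ B^s_{p,c₀}(𝕋^d)` since the torus is bounded
(`MemBesovSup.memBesovSupVanishing_of_lt'`, packaged as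
`IsSmooth.memBesovSupVanishing_of_memBesovSup`; difference-quotient counterpart of
`B^{1/3}_{3,p} ⊂ B^{1/3}_{3,c(ℕ)}`, CCFS 2008, §3.2, p. 6). [cite: CCFS2008, §3.2] -/
theorem IsSmooth.memBesovSupVanishing_holds :
    IsSmooth.memBesovSupVanishing (d := d) (F := F) (f := f) :=
  IsSmooth.memBesovSupVanishing_of_memBesovSup IsSmooth.memBesovSup_holds

end Torus

end Literature.Analysis.FunctionSpaces

/-! ## `B^s_{p,∞}(μ)` is a linear space: discharge of `MemBesovSup.add` -/

namespace Literature.Analysis.FunctionSpaces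

open Filter

section Add

variable {G : Type*} {F : Type*} [NormedAddCommGroup G] [MeasurableSpace G] [NormedAddCommGroup F]
  {s : ℝ} {p : ℝ≥0∞} {f g : G → F} {μ : Measure G}

/-- **Quasi-subadditivity of the difference seminorm** for a right-translation-invariant measure:
`[f + g]_{B^s_{p,∞}} ≤ C_p ([f]_{B^s_{p,∞}} + [g]_{B^s_{p,∞}})` for a.e.-strongly measurable `f, g`,
with Mathlib's quasi-triangle constant `C_p = ENNReal.LpAddConst p` (`= 1` for `1 ≤ p`, `= 2^{1/p - 1}` for
`0 < p < 1`; `eLpNorm_add_le'`), since `Δ_h (f + g) = Δ_h f + Δ_h g` and the translates are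
a.e.-strongly measurable (`aestronglyMeasurable_comp_add_right`). [folklore] -/
theorem eBesovSupSeminorm_add_le_mul [MeasurableAdd G] [μ.IsAddRightInvariant]
    (hf : AEStronglyMeasurable f μ) (hg : AEStronglyMeasurable g μ) :
    eBesovSupSeminorm s p (f + g) μ ≤
      ENNReal.LpAddConst p * (eBesovSupSeminorm s p f μ + eBesovSupSeminorm s p g μ) := by
  refine iSup₂_le fun h hh => ?_
  have hsplit : (fun x => (f + g) (x + h) - (f + g) x) =
      (fun x => f (x + h) - f x) + fun x => g (x + h) - g x := by
    funext x
    simp only [Pi.add_apply]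
    abel
  have hfm : AEStronglyMeasurable (fun x => f (x + h) - f x) μ :=
    (aestronglyMeasurable_comp_add_right hf h).sub hf
  have hgm : AEStronglyMeasurable (fun x => g (x + h) - g x) μ :=
    (aestronglyMeasurable_comp_add_right hg h).sub hg
  rw [eDiffQuotient_def, hsplit]
  calc eLpNorm ((fun x => f (x + h) - f x) + fun x => g (x + h) - g x) p μ / ENNReal.ofReal (‖h‖ ^ s)
      ≤ ENNReal.LpAddConst p * (eLpNorm (fun x => f (x + h) - f x) p μ + eLpNorm (fun x => g (x + h) - g x) p μ) /
          ENNReal.ofReal (‖h‖ ^ s) := by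
        gcongr
        exact eLpNorm_add_le' hfm hgm p
    _ = ENNReal.LpAddConst p * (eDiffQuotient s p f μ h + eDiffQuotient s p g μ h) := by
        rw [eDiffQuotient_def, eDiffQuotient_def, mul_div_assoc, ENNReal.add_div]
    _ ≤ ENNReal.LpAddConst p * (eBesovSupSeminorm s p f μ + eBesovSupSeminorm s p g μ) := by
        gcongr
        · exact eDiffQuotient_le_eBesovSupSeminorm hh
        · exact eDiffQuotient_le_eBesovSupSeminorm hh

/-- **Subadditivity of the difference seminorm** for `1 ≤ p` and a right-translation-invariant
measure: `[f + g]_{B^s_{p,∞}} ≤ [f]_{B^s_{p,∞}} + [g]_{B^s_{p,∞}}` (Minkowski's inequality in `L^p`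
applied to `Δ_h (f + g) = Δ_h f + Δ_h g`). [folklore] -/
theorem eBesovSupSeminorm_add_le [MeasurableAdd G] [μ.IsAddRightInvariant] (hp : 1 ≤ p)
    (hf : AEStronglyMeasurable f μ) (hg : AEStronglyMeasurable g μ) :
    eBesovSupSeminorm s p (f + g) μ ≤ eBesovSupSeminorm s p f μ + eBesovSupSeminorm s p g μ := by
  have h := eBesovSupSeminorm_add_le_mul (s := s) (p := p) hf hg
  rwa [ENNReal.LpAddConst_of_one_le hp, one_mul] at h

/-- **Discharge of the named fact `MemBesovSup.add`** (`B^s_{p,∞}(μ)` is closed under addition for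
a right-translation-invariant `μ` on a measurable group, for every `s` and every exponent `p`):
`f + g ∈ L^p` (`MemLp.add`) and `[f + g] ≤ C_p ([f] + [g]) < ∞`
(`eBesovSupSeminorm_add_le_mul`, `ENNReal.LpAddConst_lt_top`). Triebel 1983, §2.5.12 treats
`B^s_{p,q}(ℝⁿ)` through the equivalent difference quasi-norms (Thm. 2.5.12, eq. (4)) as
quasi-normed linear spaces; the linear-space property in the difference form is this elementary
estimate. [cite: Triebel1983, Thm. 2.5.12] -/
theorem MemBesovSup.add_holds : MemBesovSup.add (s := s) (p := p) (f := f) (μ := μ) := by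
  intro _ _ g hf hg
  refine ⟨hf.1.add hg.1, ?_⟩
  refine (eBesovSupSeminorm_add_le_mul hf.1.1 hg.1.1).trans_lt ?_
  exact ENNReal.mul_lt_top (ENNReal.LpAddConst_lt_top p) (ENNReal.add_lt_top.2 ⟨hf.2, hg.2⟩)

/-- `B^s_{p,∞}(μ)` is closed under addition (right-translation-invariant `μ`): the named fact
`MemBesovSup.add` as a usable implication. [folklore] -/
theorem MemBesovSup.add' [MeasurableAdd G] [μ.IsAddRightInvariant] (hf : MemBesovSup s p f μ)
    (hg : MemBesovSup s p g μ) : MemBesovSup s p (f + g) μ :=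
  MemBesovSup.add_holds hf hg

/-- `B^s_{p,∞}(μ)` is closed under subtraction (right-translation-invariant `μ`). [folklore] -/
theorem MemBesovSup.sub' [MeasurableAdd G] [μ.IsAddRightInvariant] (hf : MemBesovSup s p f μ)
    (hg : MemBesovSup s p g μ) : MemBesovSup s p (f - g) μ := by
  rw [sub_eq_add_neg]
  exact hf.add' hg.neg

/-- The difference seminorm only depends on the `μ`-a.e. class of the function, for a
right-translation-invariant `μ` (translations then preserve null sets). [folklore] -/
theorem eBesovSupSeminorm_congr_of_ae_eq [MeasurableAdd G] [μ.IsAddRightInvariant]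
    (hfg : f =ᵐ[μ] g) : eBesovSupSeminorm s p f μ = eBesovSupSeminorm s p g μ := by
  simp only [eBesovSupSeminorm, eDiffQuotient]
  congr 1
  funext h
  congr 1
  funext _
  rw [eLpNorm_congr_ae]
  filter_upwards [hfg, (measurePreserving_add_right μ h).quasiMeasurePreserving.ae_eq_comp hfg]
    with x hx hx'
  simp only [Function.comp_apply] at hx'
  rw [hx, hx']

/-- `B^s_{p,∞}(μ)` membership only depends on the `μ`-a.e. class (right-translation-invariant
`μ`). [folklore] -/
theorem MemBesovSup.ae_eq [MeasurableAdd G] [μ.IsAddRightInvariant] (hf : MemBesovSup s p f μ)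
    (hfg : f =ᵐ[μ] g) : MemBesovSup s p g μ :=
  ⟨hf.1.ae_eq hfg, by rw [← eBesovSupSeminorm_congr_of_ae_eq hfg]; exact hf.2⟩

end Add

end Literature.Analysis.FunctionSpaces
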